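import Literature.Probability.LatticeModels.DobrushinMetricStates

/-!
# Crux `IR` (item stmt-QuantumFields-19354) — line «maximal correlation at one physical thickness»:
the single-site HEAT BATH of a specification in `L²` of a Gibbs measure, and the random-scan operator

Helper module for item `stmt-QuantumFields-19354` (`--supports … --as helper`; it closes nothing; lead prover
ym-ir-line-mxc-p1, g2).  Toolkit for the g2 route to the registered stub `ShellMaxCorr.stub_shellRung : ShellRung`
(`Theorems/IR/ShellMaxCorrDefs.lean`), consumed by `Theorems/IR/ShellMaxCorrPoincare.lean` (Dobrushin ⇒ dimension-free
Poincaré inequality for the heat bath).  For a GENERAL specification `γ` on `V → S` (Georgii's sense,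
`Literature.Probability.LatticeModels.IsSpecification`), its single-site averaging operators
`T_x f (η) = ∫ f dγ_{x}(·|η)` (`DobrushinMetric.siteAvg`) and a Gibbs measure `μ`:

* §0 coordinatewise Lipschitz bounds (`DobrushinMetric.IsLipBound`): sums, scalings, the bound `2M` of a bounded
  observable for the discrete weight, invariance under subtracting constants;
* §1 single-site algebra in `L²(μ)`: `T_x` does not depend on the spin at `x`, commutes with `x`-independent multipliers
  (properness), is idempotent, `μ`-invariant (DLR) and symmetric (`integral_siteAvg_mul_comm`), and the heat-bath
  Dirichlet form at `x` is `∫ (g − T_x g)² dμ = ∫ g² − ∫ (T_x g)²` (`integral_sq_sub_siteAvg`);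
* §2 (finite `V`) the random-scan operator `P f = (card V)⁻¹ ∑_x T_x f` (passed as a hypothesis `hP`, no definition): measurable, bounded, `μ`-invariant,
  symmetric together with its iterates, and — under Dobrushin's condition in the Vasserstein form
  `DobrushinMetric.IsKRContraction γ r nbr C` with row sums `∑_y C x y ≤ α` — the `ℓ¹`-CONTRACTION of Lipschitz vectors
  `∑_y δ_y(P^k f) ≤ (1 − (1−α)/card V)^k ∑_y δ_y(f)` (`exists_isLipBound_scan_iterate`; Föllmer's dusting estimate
  `DobrushinMetric.isLipBound_siteAvg` averaged over the updated site).

HONEST FRAMING: abstract probability; nothing here is specific to Yang–Mills and nothing here proves `ShellRung`, the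
loads, or any mass gap.

Refs: H. Föllmer, LNM 1362 (1988) Ch. I, (2.4), Lemma (2.5); H.-O. Georgii, *Gibbs Measures and Phase Transitions*
(2011), Def. 1.23, Rem. 1.24; F. Martinelli, LNM 1717 (1999) §3 (heat-bath dynamics).
-/

set_option autoImplicit false

noncomputable section

open MeasureTheory ProbabilityTheory Finset Function Filter
open Literature.Probability.LatticeModels Literature.Probability.LatticeModels.DobrushinMetric

namespace Summit.QuantumFields.YangMills.Cruxes.IR.ShellMaxCorr.HeatBath

/-! ## §0 Coordinatewise Lipschitz bounds: sums, scalings, constants -/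

section Lip

variable {V S : Type*} {r : S → S → ℝ}

/-- Lipschitz bounds are stable under finite sums. -/
theorem isLipBound_sum {ι : Type*} (s : Finset ι) {f : ι → (V → S) → ℝ} {δ : ι → V → ℝ}
    (h : ∀ i ∈ s, IsLipBound r (f i) (δ i)) :
    IsLipBound r (fun σ => ∑ i ∈ s, f i σ) (fun y => ∑ i ∈ s, δ i y) := by
  refine ⟨fun y => sum_nonneg fun i hi => (h i hi).nonneg y, fun y σ τ hστ => ?_⟩
  rw [← sum_sub_distrib, sum_mul]
  exact (abs_sum_le_sum_abs _ _).trans (sum_le_sum fun i hi => (h i hi).le y σ τ hστ)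

/-- Lipschitz bounds are stable under nonnegative scalings. -/
theorem isLipBound_const_mul {f : (V → S) → ℝ} {δ : V → ℝ} (h : IsLipBound r f δ) {c : ℝ} (hc : 0 ≤ c) :
    IsLipBound r (fun σ => c * f σ) (fun y => c * δ y) := by
  refine ⟨fun y => mul_nonneg hc (h.nonneg y), fun y σ τ hστ => ?_⟩
  rw [← mul_sub, abs_mul, abs_of_nonneg hc, mul_assoc]
  exact mul_le_mul_of_nonneg_left (h.le y σ τ hστ) hc

/-- A bounded observable has the Lipschitz bound `2M` at every site for the discrete weight `r ≡ 1`. -/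
theorem isLipBound_one_of_abs_le [Nonempty S] {f : (V → S) → ℝ} {M : ℝ} (hM : ∀ σ, |f σ| ≤ M) :
    IsLipBound (fun _ _ => (1 : ℝ)) f fun _ => 2 * M := by
  have hM0 : 0 ≤ M := (abs_nonneg _).trans (hM fun _ => Classical.arbitrary S)
  refine ⟨fun _ => by linarith, fun y σ τ _ => ?_⟩
  rw [mul_one]
  calc |f σ - f τ| ≤ |f σ| + |f τ| := abs_sub _ _
    _ ≤ M + M := add_le_add (hM σ) (hM τ)
    _ = 2 * M := by ring

/-- A Lipschitz bound of `f` is one of `f − c`. -/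
theorem isLipBound_sub_const {f : (V → S) → ℝ} {δ : V → ℝ} (h : IsLipBound r f δ) (c : ℝ) :
    IsLipBound r (fun σ => f σ - c) δ :=
  ⟨h.nonneg, fun y σ τ hστ => by simpa using h.le y σ τ hστ⟩

end Lip

/-! ## §1 Single-site averaging operators in `L²` of a Gibbs measure -/

section SingleSite

variable {V S : Type*} [MeasurableSpace S] {γ : Specification V S}
  {r : S → S → ℝ} {nbr : V → Finset V} {C : V → V → ℝ} [DecidableEq V]

/-- `T_x f` does not depend on the spin at `x` (finite range of the one-site law and idempotence of updates). -/
theorem siteAvg_update (hγ : IsSpecification γ) (hC : IsKRContraction γ r nbr C) (x : V)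
    {f : (V → S) → ℝ} (hfm : Measurable f) (η : V → S) (t : S) :
    siteAvg γ x f (update η x t) = siteAvg γ x f η := by
  rw [siteAvg_eq_integral_siteLaw hγ x hfm, siteAvg_eq_integral_siteLaw hγ x hfm,
    hC.siteLaw_congr_of_eq_off x (ω := update η x t) (η := η) (fun z hz => update_of_ne hz _ _)]
  refine integral_congr_ae (ae_of_all _ fun s => ?_)
  simp only [update_idem]

/-- `T_x` of an `x`-independent observable is the observable itself (the one-site kernels are probability
measures). -/
theorem siteAvg_of_forall_update (hγ : IsSpecification γ) (x : V) {u : (V → S) → ℝ} (hum : Measurable u)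
    (hu : ∀ η s, u (update η x s) = u η) (η : V → S) : siteAvg γ x u η = u η := by
  haveI := isProbabilityMeasure_siteLaw hγ x η
  rw [siteAvg_eq_integral_siteLaw hγ x hum]
  simp_rw [hu]
  simp

/-- **`T_x` commutes with `x`-independent multipliers** (properness): `T_x (u·h) = u · T_x h` if `u` does not depend
on the spin at `x`. -/
theorem siteAvg_mul_left (hγ : IsSpecification γ) (x : V) {u h : (V → S) → ℝ} (hum : Measurable u)
    (hhm : Measurable h) (hu : ∀ η s, u (update η x s) = u η) (η : V → S) :
    siteAvg γ x (fun σ => u σ * h σ) η = u η * siteAvg γ x h η := by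
  have hm : Measurable (fun σ => u σ * h σ) := hum.mul hhm
  rw [siteAvg_eq_integral_siteLaw hγ x hm, siteAvg_eq_integral_siteLaw hγ x hhm]
  simp_rw [hu]
  exact integral_const_mul _ _

/-- **Idempotence** `T_x T_x = T_x`. -/
theorem siteAvg_siteAvg (hγ : IsSpecification γ) (hC : IsKRContraction γ r nbr C) (x : V)
    {f : (V → S) → ℝ} (hfm : Measurable f) (η : V → S) :
    siteAvg γ x (siteAvg γ x f) η = siteAvg γ x f η :=
  siteAvg_of_forall_update hγ x (measurable_siteAvg hγ x hfm) (siteAvg_update hγ hC x hfm) η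

omit [DecidableEq V] in
/-- `T_x (f − c) = T_x f − c`. -/
theorem siteAvg_sub_const (hγ : IsSpecification γ) (x : V) {f : (V → S) → ℝ} (hfm : Measurable f) {M : ℝ}
    (hM : ∀ σ, |f σ| ≤ M) (c : ℝ) (η : V → S) :
    siteAvg γ x (fun σ => f σ - c) η = siteAvg γ x f η - c := by
  haveI := hγ.isProbability {x} η
  unfold siteAvg
  rw [integral_sub (integrable_of_abs_le' hfm hM) (integrable_const c)]
  simp

variable {μ : Measure (V → S)}

omit [DecidableEq V] in
/-- **DLR invariance**: `∫ T_x f dμ = ∫ f dμ` for a Gibbs measure `μ`. -/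
theorem integral_siteAvg (hγ : IsSpecification γ) (hμ : IsGibbsMeasure γ μ) (x : V) {f : (V → S) → ℝ}
    (hfm : Measurable f) {M : ℝ} (hM : ∀ σ, |f σ| ≤ M) :
    ∫ η, siteAvg γ x f η ∂μ = ∫ σ, f σ ∂μ := by
  haveI := hμ.isProbabilityMeasure
  exact hμ.integral_integral_eq hγ {x} (integrable_of_abs_le' hfm hM)

/-- `∫ (T_x g) h dμ = ∫ (T_x g)(T_x h) dμ`: pull the `x`-independent factor `T_x g` through `T_x` and use DLR. -/
theorem integral_siteAvg_mul_eq (hγ : IsSpecification γ) (hC : IsKRContraction γ r nbr C)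
    (hμ : IsGibbsMeasure γ μ) (x : V) {g h : (V → S) → ℝ} (hgm : Measurable g) (hhm : Measurable h)
    {Mg Mh : ℝ} (hMg : ∀ σ, |g σ| ≤ Mg) (hMh : ∀ σ, |h σ| ≤ Mh) :
    ∫ η, siteAvg γ x g η * h η ∂μ = ∫ η, siteAvg γ x g η * siteAvg γ x h η ∂μ := by
  have hTgm : Measurable (siteAvg γ x g) := measurable_siteAvg hγ x hgm
  have hTgb : ∀ σ, |siteAvg γ x g σ| ≤ Mg := abs_siteAvg_le hγ x hMg
  have hprod : ∀ σ, |siteAvg γ x g σ * h σ| ≤ Mg * Mh := fun σ => by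
    rw [abs_mul]
    exact mul_le_mul (hTgb σ) (hMh σ) (abs_nonneg _) ((abs_nonneg _).trans (hTgb σ))
  rw [← integral_siteAvg hγ hμ x (f := fun σ => siteAvg γ x g σ * h σ) (hTgm.mul hhm) hprod]
  refine integral_congr_ae (ae_of_all _ fun η => ?_)
  exact siteAvg_mul_left hγ x hTgm hhm (siteAvg_update hγ hC x hgm) η

/-- **`T_x` is symmetric in `L²(μ)`**: `∫ (T_x g) h dμ = ∫ g (T_x h) dμ`. -/
theorem integral_siteAvg_mul_comm (hγ : IsSpecification γ) (hC : IsKRContraction γ r nbr C)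
    (hμ : IsGibbsMeasure γ μ) (x : V) {g h : (V → S) → ℝ} (hgm : Measurable g) (hhm : Measurable h)
    {Mg Mh : ℝ} (hMg : ∀ σ, |g σ| ≤ Mg) (hMh : ∀ σ, |h σ| ≤ Mh) :
    ∫ η, siteAvg γ x g η * h η ∂μ = ∫ η, g η * siteAvg γ x h η ∂μ := by
  rw [integral_siteAvg_mul_eq hγ hC hμ x hgm hhm hMg hMh]
  have h2 := integral_siteAvg_mul_eq hγ hC hμ x hhm hgm hMh hMg
  calc ∫ η, siteAvg γ x g η * siteAvg γ x h η ∂μ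
      = ∫ η, siteAvg γ x h η * siteAvg γ x g η ∂μ := by simp_rw [mul_comm]
    _ = ∫ η, siteAvg γ x h η * g η ∂μ := h2.symm
    _ = ∫ η, g η * siteAvg γ x h η ∂μ := by simp_rw [mul_comm]

/-- **The heat-bath Dirichlet form at `x`**: `∫ (g − T_x g)² dμ = ∫ g² dμ − ∫ (T_x g)² dμ`. -/
theorem integral_sq_sub_siteAvg (hγ : IsSpecification γ) (hC : IsKRContraction γ r nbr C)
    (hμ : IsGibbsMeasure γ μ) (x : V) {g : (V → S) → ℝ} (hgm : Measurable g) {Mg : ℝ}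
    (hMg : ∀ σ, |g σ| ≤ Mg) :
    ∫ η, (g η - siteAvg γ x g η) ^ 2 ∂μ = ∫ η, g η ^ 2 ∂μ - ∫ η, siteAvg γ x g η ^ 2 ∂μ := by
  haveI := hμ.isProbabilityMeasure
  have hTm : Measurable (siteAvg γ x g) := measurable_siteAvg hγ x hgm
  have hTb : ∀ σ, |siteAvg γ x g σ| ≤ Mg := abs_siteAvg_le hγ x hMg
  have hkey : ∫ η, siteAvg γ x g η * g η ∂μ = ∫ η, siteAvg γ x g η ^ 2 ∂μ := by
    rw [integral_siteAvg_mul_eq hγ hC hμ x hgm hgm hMg hMg]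
    simp_rw [pow_two]
  have hi1 : Integrable (fun η => g η ^ 2) μ := by
    refine integrable_of_abs_le' (hgm.pow_const 2) (M := Mg ^ 2) fun σ => ?_
    rw [abs_pow]; exact pow_le_pow_left₀ (abs_nonneg _) (hMg σ) 2
  have hi2 : Integrable (fun η => siteAvg γ x g η * g η) μ := by
    refine integrable_of_abs_le' (hTm.mul hgm) (M := Mg * Mg) fun σ => ?_
    rw [abs_mul]; exact mul_le_mul (hTb σ) (hMg σ) (abs_nonneg _) ((abs_nonneg _).trans (hTb σ))
  have hi3 : Integrable (fun η => siteAvg γ x g η ^ 2) μ := by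
    refine integrable_of_abs_le' (hTm.pow_const 2) (M := Mg ^ 2) fun σ => ?_
    rw [abs_pow]; exact pow_le_pow_left₀ (abs_nonneg _) (hTb σ) 2
  have hpt : (fun η => (g η - siteAvg γ x g η) ^ 2) =
      fun η => g η ^ 2 - 2 * (siteAvg γ x g η * g η) + siteAvg γ x g η ^ 2 := by
    funext η; ring
  have hi2' : Integrable (fun η => 2 * (siteAvg γ x g η * g η)) μ := hi2.const_mul 2
  have hi12 : Integrable (fun η => g η ^ 2 - 2 * (siteAvg γ x g η * g η)) μ := hi1.sub hi2'
  rw [hpt, integral_add hi12 hi3, integral_sub hi1 hi2', integral_const_mul, hkey]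
  ring

end SingleSite

/-! ## §2 The random-scan operator and the contraction of Lipschitz vectors -/

section Scan

variable {V S : Type*} [MeasurableSpace S] {γ : Specification V S}
  {r : S → S → ℝ} {nbr : V → Finset V} {C : V → V → ℝ} [Fintype V] [DecidableEq V]

/-! The random-scan heat-bath operator `P f = (card V)⁻¹ ∑_x T_x f` is not given a name (this helper module
declares no definitions): it enters every statement as an operator `P` together with the hypothesis
`hP : ∀ f η, P f η = (card V)⁻¹ ∑_x T_x f η`. -/

variable {P : ((V → S) → ℝ) → (V → S) → ℝ}

omit [DecidableEq V] in
/-- `P f` is measurable. -/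
theorem measurable_scan (hγ : IsSpecification γ) 
    (hP : ∀ f η, P f η = (Fintype.card V : ℝ)⁻¹ * ∑ x, siteAvg γ x f η)
    {f : (V → S) → ℝ} (hfm : Measurable f) :
    Measurable (P f) := by
  have h : P f = fun η => (Fintype.card V : ℝ)⁻¹ * ∑ x, siteAvg γ x f η := funext (hP f)
  rw [h]
  exact (Finset.measurable_sum _ fun x _ => measurable_siteAvg hγ x hfm).const_mul _

omit [DecidableEq V] in
/-- `|P f| ≤ M` if `|f| ≤ M`. -/
theorem abs_scan_le [Nonempty V] (hγ : IsSpecification γ) 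
    (hP : ∀ f η, P f η = (Fintype.card V : ℝ)⁻¹ * ∑ x, siteAvg γ x f η)
    {f : (V → S) → ℝ} {M : ℝ} (hM : ∀ σ, |f σ| ≤ M)
    (η : V → S) : |P f η| ≤ M := by
  have hn : (0 : ℝ) < Fintype.card V := by exact_mod_cast Fintype.card_pos
  rw [hP, abs_mul, abs_inv, abs_of_pos hn]
  calc (Fintype.card V : ℝ)⁻¹ * |∑ x, siteAvg γ x f η|
      ≤ (Fintype.card V : ℝ)⁻¹ * ∑ x, |siteAvg γ x f η| := by
        gcongr; exact abs_sum_le_sum_abs _ _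
    _ ≤ (Fintype.card V : ℝ)⁻¹ * ∑ _x : V, M := by
        gcongr with x; exact abs_siteAvg_le hγ x hM η
    _ = M := by
        rw [sum_const, card_univ, nsmul_eq_mul, ← mul_assoc, inv_mul_cancel₀ hn.ne', one_mul]

omit [DecidableEq V] in
/-- Iterates of `P` are measurable and bounded. -/
theorem measurable_scan_iterate [Nonempty V] (hγ : IsSpecification γ) 
    (hP : ∀ f η, P f η = (Fintype.card V : ℝ)⁻¹ * ∑ x, siteAvg γ x f η)
    {f : (V → S) → ℝ} (hfm : Measurable f)
    {M : ℝ} (hM : ∀ σ, |f σ| ≤ M) (k : ℕ) :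
    Measurable (P^[k] f) ∧ ∀ σ, |P^[k] f σ| ≤ M := by
  induction k with
  | zero => exact ⟨hfm, hM⟩
  | succ k ih =>
    rw [iterate_succ_apply']
    exact ⟨measurable_scan hγ hP ih.1, abs_scan_le hγ hP ih.2⟩

variable {μ : Measure (V → S)}

omit [DecidableEq V] in
/-- **Invariance** `∫ P f dμ = ∫ f dμ`. -/
theorem integral_scan [Nonempty V] (hγ : IsSpecification γ) 
    (hP : ∀ f η, P f η = (Fintype.card V : ℝ)⁻¹ * ∑ x, siteAvg γ x f η)
    (hμ : IsGibbsMeasure γ μ) {f : (V → S) → ℝ}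
    (hfm : Measurable f) {M : ℝ} (hM : ∀ σ, |f σ| ≤ M) :
    ∫ η, P f η ∂μ = ∫ σ, f σ ∂μ := by
  haveI := hμ.isProbabilityMeasure
  have hn : (0 : ℝ) < Fintype.card V := by exact_mod_cast Fintype.card_pos
  have h : P f = fun η => (Fintype.card V : ℝ)⁻¹ * ∑ x, siteAvg γ x f η := funext (hP f)
  rw [h, integral_const_mul, integral_finsetSum _ fun x _ =>
    integrable_of_abs_le' (measurable_siteAvg hγ x hfm) (abs_siteAvg_le hγ x hM)]
  simp_rw [integral_siteAvg hγ hμ _ hfm hM]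
  rw [sum_const, card_univ, nsmul_eq_mul, ← mul_assoc, inv_mul_cancel₀ hn.ne', one_mul]

omit [DecidableEq V] in
/-- `∫ P^[k] f dμ = ∫ f dμ`. -/
theorem integral_scan_iterate [Nonempty V] (hγ : IsSpecification γ) 
    (hP : ∀ f η, P f η = (Fintype.card V : ℝ)⁻¹ * ∑ x, siteAvg γ x f η)
    (hμ : IsGibbsMeasure γ μ)
    {f : (V → S) → ℝ} (hfm : Measurable f) {M : ℝ} (hM : ∀ σ, |f σ| ≤ M) (k : ℕ) :
    ∫ η, P^[k] f η ∂μ = ∫ σ, f σ ∂μ := by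
  induction k with
  | zero => rfl
  | succ k ih =>
    have h := measurable_scan_iterate hγ hP hfm hM k
    rw [iterate_succ_apply', integral_scan hγ hP hμ h.1 h.2, ih]

/-- **`P` is symmetric in `L²(μ)`**. -/
theorem integral_scan_mul_comm [Nonempty V] (hγ : IsSpecification γ) 
    (hP : ∀ f η, P f η = (Fintype.card V : ℝ)⁻¹ * ∑ x, siteAvg γ x f η)
    (hC : IsKRContraction γ r nbr C)
    (hμ : IsGibbsMeasure γ μ) {g h : (V → S) → ℝ} (hgm : Measurable g) (hhm : Measurable h)
    {Mg Mh : ℝ} (hMg : ∀ σ, |g σ| ≤ Mg) (hMh : ∀ σ, |h σ| ≤ Mh) :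
    ∫ η, P g η * h η ∂μ = ∫ η, g η * P h η ∂μ := by
  haveI := hμ.isProbabilityMeasure
  have hint : ∀ x, Integrable (fun η => siteAvg γ x g η * h η) μ := fun x => by
    refine integrable_of_abs_le' ((measurable_siteAvg hγ x hgm).mul hhm) (M := Mg * Mh) fun σ => ?_
    rw [abs_mul]
    exact mul_le_mul (abs_siteAvg_le hγ x hMg σ) (hMh σ) (abs_nonneg _)
      ((abs_nonneg _).trans (abs_siteAvg_le hγ x hMg σ))
  have hint' : ∀ x, Integrable (fun η => g η * siteAvg γ x h η) μ := fun x => by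
    refine integrable_of_abs_le' (hgm.mul (measurable_siteAvg hγ x hhm)) (M := Mg * Mh) fun σ => ?_
    rw [abs_mul]
    exact mul_le_mul (hMg σ) (abs_siteAvg_le hγ x hMh σ) (abs_nonneg _) ((abs_nonneg _).trans (hMg σ))
  have lhs : ∫ η, P g η * h η ∂μ = (Fintype.card V : ℝ)⁻¹ * ∑ x, ∫ η, siteAvg γ x g η * h η ∂μ := by
    have : (fun η => P g η * h η) = fun η => (Fintype.card V : ℝ)⁻¹ * ∑ x, siteAvg γ x g η * h η := by
      funext η; simp only [hP]; rw [mul_assoc, sum_mul]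
    rw [this, integral_const_mul, integral_finsetSum _ (fun x _ => hint x)]
  have rhs : ∫ η, g η * P h η ∂μ = (Fintype.card V : ℝ)⁻¹ * ∑ x, ∫ η, g η * siteAvg γ x h η ∂μ := by
    have : (fun η => g η * P h η) = fun η => (Fintype.card V : ℝ)⁻¹ * ∑ x, g η * siteAvg γ x h η := by
      funext η; simp only [hP]; rw [mul_left_comm, mul_sum]
    rw [this, integral_const_mul, integral_finsetSum _ (fun x _ => hint' x)]
  rw [lhs, rhs]
  congr 1
  exact sum_congr rfl fun x _ => integral_siteAvg_mul_comm hγ hC hμ x hgm hhm hMg hMh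

/-- Symmetry of the iterates: `∫ (P^[k] g) h dμ = ∫ g (P^[k] h) dμ`. -/
theorem integral_scan_iterate_mul_comm [Nonempty V] (hγ : IsSpecification γ) 
    (hP : ∀ f η, P f η = (Fintype.card V : ℝ)⁻¹ * ∑ x, siteAvg γ x f η)
    (hC : IsKRContraction γ r nbr C)
    (hμ : IsGibbsMeasure γ μ) (k : ℕ) :
    ∀ {g h : (V → S) → ℝ}, Measurable g → Measurable h → ∀ {Mg Mh : ℝ}, (∀ σ, |g σ| ≤ Mg) →
      (∀ σ, |h σ| ≤ Mh) → ∫ η, P^[k] g η * h η ∂μ = ∫ η, g η * P^[k] h η ∂μ := by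
  induction k with
  | zero => intros; rfl
  | succ k ih =>
    intro g h hgm hhm Mg Mh hMg hMh
    have hPh := measurable_scan_iterate hγ hP hhm hMh k
    rw [iterate_succ_apply, iterate_succ_apply',
      ih (measurable_scan hγ hP hgm) hhm (abs_scan_le hγ hP hMg) hMh,
      ← integral_scan_mul_comm hγ hP hC hμ hgm hPh.1 hMg hPh.2]

/-- **One scan step contracts the `ℓ¹`-norm of the Lipschitz vector** by `θ = 1 − (1 − α)/card V` (Föllmer's
dusting estimate averaged over the updated site; `α` bounds Dobrushin's row sums). -/
theorem exists_isLipBound_scan [Nonempty V] (hγ : IsSpecification γ) 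
    (hP : ∀ f η, P f η = (Fintype.card V : ℝ)⁻¹ * ∑ x, siteAvg γ x f η)
    (hC : IsKRContraction γ r nbr C)
    {α : ℝ} (hrow : ∀ x, ∑ y ∈ nbr x, C x y ≤ α) {f : (V → S) → ℝ} (hfm : Measurable f) {M : ℝ}
    (hM : ∀ σ, |f σ| ≤ M) {δ : V → ℝ} (hδ : IsLipBound r f δ) :
    ∃ δ' : V → ℝ, IsLipBound r (P f) δ' ∧
      ∑ y, δ' y ≤ (1 - (1 - α) / Fintype.card V) * ∑ y, δ y := by
  have hn : (0 : ℝ) < Fintype.card V := by exact_mod_cast Fintype.card_pos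
  set δx : V → V → ℝ := fun x y => if y = x then 0 else δ y + (if y ∈ nbr x then C x y else 0) * δ x
    with hδx
  have hTx : ∀ x ∈ (univ : Finset V), IsLipBound r (siteAvg γ x f) (δx x) := fun x _ =>
    isLipBound_siteAvg hγ hC x hfm hM hδ
  have hPf : P f = fun σ => (Fintype.card V : ℝ)⁻¹ * ∑ x, siteAvg γ x f σ := funext (hP f)
  refine ⟨fun y => (Fintype.card V : ℝ)⁻¹ * ∑ x, δx x y, ?_, ?_⟩
  · rw [hPf]; exact isLipBound_const_mul (isLipBound_sum univ hTx) (inv_nonneg.2 hn.le)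
  -- the sum of the new Lipschitz vector
  have hδ0 : ∀ y, 0 ≤ δ y := hδ.nonneg
  have hinner : ∀ x, ∑ y, δx x y ≤ (∑ y, δ y) - (1 - α) * δ x := by
    intro x
    have h1 : ∑ y, δx x y = ∑ y ∈ univ.erase x, (δ y + (if y ∈ nbr x then C x y else 0) * δ x) := by
      rw [← sum_erase_add _ _ (mem_univ x)]
      simp only [hδx, if_pos rfl, add_zero]
      exact sum_congr rfl fun y hy => by rw [if_neg (ne_of_mem_erase hy)]
    have h2 : ∑ y ∈ univ.erase x, (if y ∈ nbr x then C x y else 0) * δ x ≤ α * δ x := by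
      rw [← sum_mul]
      refine mul_le_mul_of_nonneg_right ?_ (hδ0 x)
      calc ∑ y ∈ univ.erase x, (if y ∈ nbr x then C x y else 0)
          ≤ ∑ y, (if y ∈ nbr x then C x y else 0) :=
            sum_le_sum_of_subset_of_nonneg (erase_subset _ _) fun y _ _ => by
              split_ifs; exacts [hC.nonneg x y, le_rfl]
        _ = ∑ y ∈ nbr x, C x y := by
            rw [← sum_filter]; exact sum_congr (by ext y; simp) fun _ _ => rfl
        _ ≤ α := hrow x
    have h3 : ∑ y ∈ univ.erase x, δ y = (∑ y, δ y) - δ x := by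
      rw [← sum_erase_add _ _ (mem_univ x)]; ring
    rw [h1, sum_add_distrib, h3]
    linarith
  calc ∑ y, (Fintype.card V : ℝ)⁻¹ * ∑ x, δx x y
      = (Fintype.card V : ℝ)⁻¹ * ∑ x, ∑ y, δx x y := by rw [← mul_sum, sum_comm]
    _ ≤ (Fintype.card V : ℝ)⁻¹ * ∑ x, ((∑ y, δ y) - (1 - α) * δ x) := by
        gcongr with x; exact hinner x
    _ = (1 - (1 - α) / Fintype.card V) * ∑ y, δ y := by
        rw [sum_sub_distrib, sum_const, card_univ, nsmul_eq_mul, ← mul_sum]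
        field_simp

/-- **`k` scan steps contract the `ℓ¹`-norm of the Lipschitz vector by `θ^k`.** -/
theorem exists_isLipBound_scan_iterate [Nonempty V] (hγ : IsSpecification γ) 
    (hP : ∀ f η, P f η = (Fintype.card V : ℝ)⁻¹ * ∑ x, siteAvg γ x f η)
    (hC : IsKRContraction γ r nbr C)
    {α : ℝ} (hrow : ∀ x, ∑ y ∈ nbr x, C x y ≤ α) {f : (V → S) → ℝ} (hfm : Measurable f) {M : ℝ}
    (hM : ∀ σ, |f σ| ≤ M) {δ : V → ℝ} (hδ : IsLipBound r f δ) (k : ℕ) :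
    ∃ δ' : V → ℝ, IsLipBound r (P^[k] f) δ' ∧
      ∑ y, δ' y ≤ (1 - (1 - α) / Fintype.card V) ^ k * ∑ y, δ y := by
  induction k with
  | zero => exact ⟨δ, hδ, by simp⟩
  | succ k ih =>
    obtain ⟨δ₁, hδ₁, hsum₁⟩ := ih
    have hk := measurable_scan_iterate hγ hP hfm hM k
    obtain ⟨δ₂, hδ₂, hsum₂⟩ := exists_isLipBound_scan hγ hP hC hrow hk.1 hk.2 hδ₁
    refine ⟨δ₂, by rwa [iterate_succ_apply'], hsum₂.trans ?_⟩
    have hθ0 : 0 ≤ 1 - (1 - α) / (Fintype.card V : ℝ) := by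
      have hn : (1 : ℝ) ≤ Fintype.card V := by exact_mod_cast Fintype.card_pos
      have hα0 : 0 ≤ α :=
        (sum_nonneg fun y _ => hC.nonneg _ y).trans (hrow (Classical.arbitrary V))
      have : (1 - α) / (Fintype.card V : ℝ) ≤ 1 := by
        rw [div_le_one (by linarith)]; linarith
      linarith
    rw [pow_succ', mul_assoc]
    exact mul_le_mul_of_nonneg_left hsum₁ hθ0

end Scan

end Summit.QuantumFields.YangMills.Cruxes.IR.ShellMaxCorr.HeatBath

end
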